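import Summits.Ventures.HSemireg.WedgeHankelClassMapMatrix
import Summits.Ventures.HSemireg.WedgeHankelOuterFamily

/-!
# Venture HSemireg — THE BLOCK HANKEL MATRIX IS THE MATRIX OF A FAMILY'S CLASS MAP: a class `w_k(c)` of the first `k` pairs is killed by EVERY class `w_N(q_{c′})` of a finite family
# iff the twisted window `(r ↦ (−1)^r C(k,r) c_{k−r})` lies in the left kernel of th-7's block matrix `[H_k(q_{c′})]_{c′}` — J1's «block Hankel rank» is the rank of THIS matrix

HONEST FRAMING. Part of the Lean index of the computation cell `pub-hsemireg` (seat p10 gen 24, Sunday typer «UNIFORM-IN-n»).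
Finite-dimensional EXTERIOR ALGEBRA over a field + th-7's apolar pairing ONLY: no variety, no cohomology theory, no sheaf, no Ext group, no semiregularity map;
nothing here says that HC / HC_CM / HC_AV holds; no Literature fact is declared or used.  Custodian versions as in `WedgeHankelSiegelIdeal` (1/3); dictionary QUOTED, never asserted.

WHAT IS IN THE TREE.  M8 (this seat, `WedgeHankelClassMapMatrix`): `w_mul_w_top_eq_zero_iff_vecMul_hankel1`, `vecMul_twist_hankel1_apply`; th-7's `hank` (`WedgeHankelTuples`), `hankel1`; J1
(`WedgeHankelOuterFamily`): the joint kernel law with `rank (hank K N k q)`.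
THIS FILE (namespace `Summit.Ventures.HSemireg.Wedge.HankelOuter` continued; imports M8 and J1):
* §419 `hank_apply_eq_hankel1` (the block matrix entry `((), r), (c′, t)` is `H_k(q_{c′}) r t`), `vecMul_hank_apply` (`(v ᵥ* [H_k(q_{c′})]) (c′, t) = ((v ((), ·)) ᵥ* H_k(q_{c′})) t`),
  `vecMul_hank_eq_zero_iff` (blockwise), **`forall_w_mul_w_eq_zero_iff_vecMul_hank`**: `(∀ c′, w_k(c) ∧ w_N(q_{c′}) = 0) ↔ (fun (_, r) => (−1)^r C(k,r) c_{k−r}) ᵥ* hank K N k q = 0`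
  (`k ≤ N`), and the joint-kernel form **`w_mem_Hom_iInf_Kr_w_iff_vecMul_hank`**.
READING: M8 blockwise; the block Hankel rank in (183)/(185) is the rank of the family's class map on the sub-box classes, in the class coordinates.  Nothing Ext-side.  New names only.
-/

open Module

namespace Summit.Ventures.HSemireg.Wedge.HankelOuter

open Summit.Ventures.HSemireg.Wedge Summit.Ventures.HSemireg.Wedge.Kunneth Summit.Ventures.HSemireg.Wedge.Hankel
  Summit.Ventures.HSemireg.Wedge.BasisFree Summit.Ventures.HSemireg.Wedge.HankelSiegel Summit.Ventures.HSemireg.Wedge.HankelSiegelIdeal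
  Summit.Ventures.HSemireg.Wedge.KunnethKernel Summit.Ventures.HSemireg.Wedge.HankelFrameChange Summit.Ventures.HSemireg.Wedge.KernelDuality

variable (K : Type*) [Field K] {N : ℕ} {ι : Type}

/-! ## §419. The block Hankel matrix is the matrix of the family's class map -/

omit [Field K] in
/-- the block matrix of a family, entrywise: `[H_k(q_{c′})]_{c′} ((), r) (c′, t) = H_k(q_{c′}) r t`. -/
theorem hank_apply_eq_hankel1 (k : ℕ) (q : ι → ℕ → K) (r : Fin (k + 1)) (c' : ι) (t : Fin (N + 1 - k)) :
    hank K N k (fun (_ : Unit) (c : ι) => q c) ((), r) (c', t) = hankel1 K N k (q c') r t := by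
  simp only [hank, hank', hankel1, Matrix.of_apply]

/-- `(v ᵥ* [H_k(q_{c′})]_{c′}) (c′, t) = ((r ↦ v ((), r)) ᵥ* H_k(q_{c′})) t` (block columns). -/
theorem vecMul_hank_apply (k : ℕ) (q : ι → ℕ → K) (v : Unit × Fin (k + 1) → K) (c' : ι) (t : Fin (N + 1 - k)) :
    Matrix.vecMul v (hank K N k (fun (_ : Unit) (c : ι) => q c)) (c', t) = Matrix.vecMul (fun r : Fin (k + 1) => v ((), r)) (hankel1 K N k (q c')) t := by
  rw [Matrix.vecMul, Matrix.vecMul, dotProduct, dotProduct, Fintype.sum_prod_type, Fintype.sum_unique]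
  refine Finset.sum_congr rfl fun r _ => ?_
  rw [hank_apply_eq_hankel1]

/-- blockwise: `v ᵥ* [H_k(q_{c′})]_{c′} = 0 ↔ ∀ c′, (r ↦ v ((), r)) ᵥ* H_k(q_{c′}) = 0`. -/
theorem vecMul_hank_eq_zero_iff (k : ℕ) (q : ι → ℕ → K) (v : Unit × Fin (k + 1) → K) :
    Matrix.vecMul v (hank K N k (fun (_ : Unit) (c : ι) => q c)) = 0 ↔ ∀ c', Matrix.vecMul (fun r : Fin (k + 1) => v ((), r)) (hankel1 K N k (q c')) = 0 := by
  constructor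
  · intro h c'
    funext t
    rw [← vecMul_hank_apply, h, Pi.zero_apply, Pi.zero_apply]
  · intro h
    funext ⟨c', t⟩
    rw [vecMul_hank_apply, h c', Pi.zero_apply, Pi.zero_apply]

/-- **THE BLOCK HANKEL MATRIX IS THE MATRIX OF THE FAMILY'S CLASS MAP: `(∀ c′, w_k(c) ∧ w_N(q_{c′}) = 0) ↔ (fun (_, r) => (−1)^r C(k,r) c_{k−r}) ᵥ* [H_k(q_{c′})]_{c′} = 0`** (`k ≤ N`, every
finite family, every field). -/
theorem forall_w_mul_w_eq_zero_iff_vecMul_hank {k : ℕ} (hk : k ≤ N) (c : ℕ → K) (q : ι → ℕ → K) :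
    (∀ c', w K N k c * w K N N (q c') = 0)
      ↔ Matrix.vecMul (fun r : Unit × Fin (k + 1) => (-1) ^ (r.2 : ℕ) * (k.choose (r.2 : ℕ) : K) * c (k - (r.2 : ℕ))) (hank K N k (fun (_ : Unit) (c : ι) => q c)) = 0 := by
  rw [vecMul_hank_eq_zero_iff]
  exact forall_congr' fun c' => w_mul_w_top_eq_zero_iff_vecMul_hankel1 K hk c (q c')

/-- joint-kernel form: **`w_k(c) ∈ Hom(Dm k, k) ⊓ ⋂_{c′} Kr(Dm k, w_N(q_{c′}), k) ↔ (fun (_, r) => (−1)^r C(k,r) c_{k−r}) ᵥ* [H_k(q_{c′})]_{c′} = 0`** (`k ≤ N`). -/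
theorem w_mem_Hom_iInf_Kr_w_iff_vecMul_hank {k : ℕ} (hk : k ≤ N) (c : ℕ → K) (q : ι → ℕ → K) :
    w K N k c ∈ Hom K (In N) (Dm N k) k ⊓ (⨅ c', Kr K (Dm N k) (w K N N (q c')) k)
      ↔ Matrix.vecMul (fun r : Unit × Fin (k + 1) => (-1) ^ (r.2 : ℕ) * (k.choose (r.2 : ℕ) : K) * c (k - (r.2 : ℕ))) (hank K N k (fun (_ : Unit) (c : ι) => q c)) = 0 := by
  rw [← forall_w_mul_w_eq_zero_iff_vecMul_hank K hk, Submodule.mem_inf, Submodule.mem_iInf, and_iff_right (w_mem_Hom K hk c)]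
  exact forall_congr' fun c' => by rw [mem_Kr, and_iff_right (w_mem_Hom K hk c)]

end Summit.Ventures.HSemireg.Wedge.HankelOuter
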